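import Summits.PneNP.PneNP.Theses.RamseyThreshold
import Literature.Computability.MetaComplexity.XorPseudoexpectation

/-!
# Birth skeleton (BC3) for piece X₁ = `SosBlindAboveThreshold` (stmt-PneNP-2051) — line `pinned-parity-lift`

Strategist decomposition of `RandomRamseyHypothesis` (stmt-PneNP-2050): X ⇐ X₁ ∧ X₂ (SOS pincer).
This file: the registered skeleton of X₁.

LINE.  The non-arrowing CNF of `G` (two NAE₆ clauses `⋁ x_e`, `⋁ ¬x_e` per `K₄`) LIFTS to the parity system
"every `K₄` has an odd number of red edges": BOTH clauses of a `K₄` have `clauseSign = -1` (arity 6 is even), so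
the Grigoriev–Schoenebeck engine of the tree (`sosFailsToRefute_of_vecExpands`) applies as soon as the family of
scope vectors is VECTOR-EXPANDING over `𝔽₂`.  Two defects of the `K₄`-hypergraph of `G(n, n^{δ-2/5})` obstruct
this verbatim: (i) the two clauses of a `K₄` share their scope (the tree engine indexes equations by clause
POSITION, so repeated scopes kill `VecExpands`); (ii) every `K₆ ⊆ G` (there are `n^{15δ} → ∞` of them) is an EVEN
COVER of size 15 (each edge lies in 6 of its `K₄`'s) with odd right-hand side: the lift is inconsistent there.
Remedy: index equations by an arbitrary family (defect (i)), and PIN the edges of the rare dense clusters to a fixed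
good colouring — unit equations — deriving the clause identities of the `K₄`'s inside a cluster by SUBSUMPTION from
a true pinned literal (defect (ii)).  What must then be supplied is new and purely combinatorial: w.h.p. the pinned
scope system of `G(n, n^{δ-2/5})` is `(r, c')`-vector-expanding up to `r = n^{Ω(1)}` (no small near-even covers
modulo pins) — `stub_expandingPinnedSystem`, the hardest stub.

* `stub_pinnedLiftEngine` — the tree engine ported to COVERING families with subsumption (deterministic, M).
* `stub_expandingPinnedSystem` — w.h.p. an expanding pinned parity system covering the CNF exists (probabilistic, L).
* `SosBlindAboveThreshold_of` — composition (measure monotonicity + squeeze), no sorry.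
-/

set_option linter.dupNamespace false
set_option linter.unusedVariables false

namespace Summit.PneNP.PneNP.Cruxes.SosBlindAboveThreshold.PinnedParityLift

open scoped Classical
open Filter Literature.Computability.Complexity Literature.Computability.MetaComplexity
open Summit.PneNP.PneNP.Theses.RamseyThreshold

/-- Registered stub statements, named (the skeleton's hypotheses refer to them BY NAME). -/
def Registered.stub_pinnedLiftEngine : Prop :=
  ∀ (m : ℕ) (g : Fin m → ParityVec) (b : Fin m → ℝ) (φ : CNF ℕ) (r c' : ℝ) (d : ℕ),
      VecExpands g r c' → 0 < c' → 2 ≤ r → (d : ℝ) ≤ c' * r / 2 → (∀ i, b i * b i = 1) →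
      (∀ C ∈ φ, ∃ C' : Clause ℕ, C'.Sublist C ∧ ∃ i, g i = clauseVec C' ∧ b i = clauseSign C') →
      SOSFailsToRefute d φ

/-- Registered stub statement (named). -/
def Registered.stub_expandingPinnedSystem : Prop :=
    ∀ δ : ℝ, 0 < δ → δ < 1 / 15 → ∃ c : ℝ, 0 < c ∧ Filter.Tendsto (fun n : ℕ => (((Literature.Probability.RandomGraphs.PlantedClique.bernoulliVec (n * n) (min 1 (ENNReal.ofReal ((n : ℝ) ^ (δ - 2 / 5)))) (min_le_left _ _)).map (fun s => SimpleGraph.fromRel fun i j : Fin n => i < j ∧ s (finProdFinEquiv (i, j)) = true))).toOuterMeasure {G | ∃ (m : ℕ) (g : Fin m → ParityVec) (b : Fin m → ℝ) (r c' : ℝ), VecExpands g r c' ∧ 0 < c' ∧ 2 ≤ r ∧ ((⌊(n : ℝ) ^ c⌋₊ : ℕ) : ℝ) ≤ c' * r / 2 ∧ (∀ i, b i * b i = 1) ∧ ∀ C ∈ (((Finset.univ.filter fun S : Finset (Fin n) => G.IsNClique 4 S).toList.flatMap fun S => [((S ×ˢ S).filter fun q : Fin n × Fin n => q.1 < q.2).toList.map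 fun q => ((q.1 : ℕ) * n + (q.2 : ℕ), true), ((S ×ˢ S).filter fun q : Fin n × Fin n => q.1 < q.2).toList.map fun q => ((q.1 : ℕ) * n + (q.2 : ℕ), false)]) : CNF ℕ), ∃ C' : Clause ℕ, C'.Sublist C ∧ ∃ i, g i = clauseVec C' ∧ b i = clauseSign C'}) Filter.atTop (nhds 1)

/-- STUB 1 (M, deterministic) — **pinned parity-lift engine**: the Grigoriev–Schoenebeck pseudoexpectation of an
`(r, c')`-vector-expanding parity system `(g, b)` (indexed by an ARBITRARY type, `b = ±1`) satisfies, in degree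
`d ≤ c' r / 2`, Booleanity and the clause identity of every clause `C` that CONTAINS (as a sublist) a clause `C'`
whose lift `(clauseVec C', clauseSign C')` is an equation of the system.  (Tree: `sosFailsToRefute_of_vecExpands`
is the case `ι = Fin φ.length`, `C' = C`; the port re-runs its Main section with the index supplied by the cover
and factors `unsatPoly C = unsatPoly C' * t`, `deg t = |C| - |C'|`, for subsumption.) -/
theorem stub_pinnedLiftEngine : Registered.stub_pinnedLiftEngine := by
  sorry

/-- STUB 2 (L, probabilistic — the HARDEST stub, the new content of X₁) — **an expanding pinned parity system
exists w.h.p.**: for `0 < δ < 1/15` there is `c > 0` such that w.h.p. over `G ∼ G(n, n^{δ-2/5})` there is a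
`±1`-signed parity system `(g, b)` on finitely many indices which is `(r, c')`-vector-expanding with
`⌊n^c⌋ ≤ c' r / 2`, `r ≥ 2`, `c' > 0`, and COVERS the non-arrowing CNF of `G`: every NAE clause of every `K₄`
contains a sub-clause whose parity lift is an equation of the system (intended witness: the full scope equation
`y_S = -1` for `K₄`'s outside the dense clusters, unit equations pinning a good colouring on the clusters —
EVERY bounded-size even cover: `K₆` (15 scopes, odd: inconsistent lift), `K₇⁻` (two `K₆`'s on a common `K₅`, δ > 1/20),
`K_{1,2,2,2}` (its 8 `K₄`'s cover every edge 2 or 4 times — a CONSISTENT dependency that still kills `VecExpands`; present for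
δ > 1/90), …; all have `e/v ≥ 5/2`, so they are `n^{O(δ)}`-rare, of bounded size and bounded-size components w.h.p. (`e/v < 3`
for δ < 1/15), hence pinnable).  Fails if even covers modulo pins of size up to `n^{c}` are unavoidable w.h.p. — e.g. if SPARSE even
covers (`e/v < 5/2`) of `K₄`-scopes exist at all (then they occur `n^{Ω(1)}` times and may chain), or if chains of `K₅`'s sharing
triangles (`n^{1/5+17δ}` pairs) assemble near-even covers at growing sizes. -/
theorem stub_expandingPinnedSystem : Registered.stub_expandingPinnedSystem := by
  sorry

/-- Probabilities of a `PMF` are at most one. [folklore] -/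
theorem pmf_toOuterMeasure_le_one {α : Type*} (p : PMF α) (S : Set α) : p.toOuterMeasure S ≤ 1 := by
  rw [PMF.toOuterMeasure_apply, ← p.tsum_coe]
  exact ENNReal.tsum_le_tsum fun x => Set.indicator_le_self S p x

/-- COMPOSITION (kernel-checked, no sorry): `stub_pinnedLiftEngine → stub_expandingPinnedSystem →
SosBlindAboveThreshold`.  Pointwise, an expanding covering system makes degree-`⌊n^c⌋` SOS fail (stub 1), so the
w.h.p. event of stub 2 is contained in the SOS-failure event; squeeze between it and `1`. -/
theorem SosBlindAboveThreshold_of (hEngine : Registered.stub_pinnedLiftEngine)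
    (hSystem : Registered.stub_expandingPinnedSystem) : SosBlindAboveThreshold := by
  intro δ hδ hδ'
  obtain ⟨c, hc, hT⟩ := hSystem δ hδ hδ'
  refine ⟨c, hc, ?_⟩
  refine tendsto_of_tendsto_of_tendsto_of_le_of_le hT tendsto_const_nhds (fun n => ?_) (fun n => ?_)
  · -- the expanding-system event is contained in the SOS-failure event (stub 1, pointwise in G)
    refine MeasureTheory.OuterMeasure.mono _ ?_
    intro G hG
    obtain ⟨m, g, b, r, c', hexp, hc', hr, hd, hb, hcov⟩ := hG
    exact hEngine m g b _ r c' _ hexp hc' hr hd hb hcov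
  · exact pmf_toOuterMeasure_le_one _ _

/-- The piece from the two registered stubs (by name). -/
theorem SosBlindAboveThreshold_closed : SosBlindAboveThreshold :=
  SosBlindAboveThreshold_of stub_pinnedLiftEngine stub_expandingPinnedSystem

end Summit.PneNP.PneNP.Cruxes.SosBlindAboveThreshold.PinnedParityLift
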